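import Literature.Probability.RandomPlanarGeometry.HexSAWBrickWallStripFugacityWidthOneContactEntropyBinary
import Literature.Probability.RandomPlanarGeometry.HexSAWBrickWallStripFugacityWidthOneContactFullLDP
import Mathlib.Analysis.Calculus.LHopital
import HarnessLib

/-!
# The curvature of the two-density contact entropy and of the joint rate: explicit Hessian, positive definiteness, quadratic germ

Child module of `…ContactEntropyBinary` (the five-term form `s = negMulLog ρ + [negMulLog P + negMulLog Q − negMulLog 2a − negMulLog 2a']/2`,
`ρ = 1−2a−2a'`, `P = 4a+2a'−1`, `Q = 2a+4a'−1`).  Along the line `t ↦ (a + t v₁, a' + t v₂)` through a point of the open triangle: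
* §1 the FIRST directional derivative of `s` is `D_v(a,a') = 2(v₁+v₂) log ρ − (2v₁+v₂) log P − (v₁+2v₂) log Q + v₁ log 2a + v₂ log 2a'`
  (`= −v₁ log Y(a,a') − v₂ log Y(a',a)`, the supergradient of `…ContactEntropyDuality`), and ★★★ the SECOND directional derivative is
  `−Q_{a,a'}(v)`, `Q_{a,a'}(v) = 4(v₁+v₂)²/ρ + 2(2v₁+v₂)²/P + 2(v₁+2v₂)²/Q − v₁²/a − v₂²/a'` — the explicit Hessian of the entropy;
* §2 ★★★ `Q_{a,a'}(v) = ((2v₁+v₂)ρ + (v₁+v₂)P)²/(aPρ) + ((v₁+2v₂)ρ + (v₁+v₂)Q)²/(a'Qρ)` (sum of two squares), hence `Q > 0` for `v ≠ 0`: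
  the Hessian of `s` is NEGATIVE DEFINITE at every point of the open triangle (strict concavity with an explicit modulus);
* §3 ★★ the joint rate `J̃_{y,z} = log μ₁(y,z) − a log y − a' log z − s` has second directional derivative `+Q_{a,a'}(v)` at every point
  (independent of `(y,z)`);
* §4 ★★★ **THE QUADRATIC GERM AT THE TYPICAL PAIR**: `J̃_{y,z}(b + t v)/t² → Q_b(v)/2` as `t → 0`, `b = (b(y,z), b(z,y))` — the rate function
  is asymptotically the quadratic form `½ Q_b`; `Q_b⁻¹` is the covariance a Gaussian (central-limit) refinement would have (NOT claimed).

## Sources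
DemboZeitouni2010 §2.2 (rate functions; their curvature at the zero) and §3.7 (moderate deviations — context only); JansevanRensburg2000 §3.3
(1st ed., OUP 2000: concavity/differentiability of density functions).  Nothing quoted AS PRINTED; the statements are this lineage's.
-/

noncomputable section

open Filter Topology Finset Literature.Probability.LatticeModels Literature.Probability.Percolation SimpleGraph

namespace Literature.Probability.RandomPlanarGeometry.SAW.HexBW

open WidthOneYZ Real

variable {y z : ℝ}

/-! ## §1 Directional derivatives of the entropy -/

/-- `t ↦ negMulLog(α + βt)` has derivative `(−log(α+βt) − 1)·β` where `α + βt ≠ 0`. [cite: DemboZeitouni2010, §2.2 (lane plumbing)] -/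
theorem hasDerivAt_negMulLog_affine {α β t : ℝ} (h : α + β * t ≠ 0) :
    HasDerivAt (fun t => negMulLog (α + β * t)) ((-Real.log (α + β * t) - 1) * β) t := by
  have h1 : HasDerivAt (fun t => α + β * t) β t := by
    simpa using ((hasDerivAt_id t).const_mul β).const_add α
  exact (Real.hasDerivAt_negMulLog h).comp t h1

/-- `t ↦ c·log(α + βt)` has derivative `c·β/(α+βt)` where `α + βt ≠ 0`. [cite: DemboZeitouni2010, §2.2 (lane plumbing)] -/
theorem hasDerivAt_const_mul_log_affine {α β t : ℝ} (c : ℝ) (h : α + β * t ≠ 0) :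
    HasDerivAt (fun t => c * Real.log (α + β * t)) (c * (β / (α + β * t))) t := by
  have h1 : HasDerivAt (fun t => α + β * t) β t := by
    simpa using ((hasDerivAt_id t).const_mul β).const_add α
  have h2 : HasDerivAt (fun t => Real.log (α + β * t)) ((α + β * t)⁻¹ * β) t := by
    exact (Real.hasDerivAt_log h).comp t h1
  refine (h2.const_mul c).congr_deriv ?_
  rw [div_eq_inv_mul]

/-- ★★ **FIRST DIRECTIONAL DERIVATIVE along a line**, at every parameter `t` whose point lies in the open triangle:
`d/dt s(a + tv₁, a' + tv₂) = 2(v₁+v₂) log ρ_t − (2v₁+v₂) log P_t − (v₁+2v₂) log Q_t + v₁ log 2(a+tv₁) + v₂ log 2(a'+tv₂)`.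
[cite: JansevanRensburg2000, §3.3 (1st ed.: differentiability of the density function; lane statement for the pair)] -/
theorem hasDerivAt_contactEntropy₂_line {a a' : ℝ} (v₁ v₂ t : ℝ) (h1 : (a + t * v₁) + (a' + t * v₂) < 1 / 2)
    (h2 : 1 < 4 * (a + t * v₁) + 2 * (a' + t * v₂)) (h3 : 1 < 2 * (a + t * v₁) + 4 * (a' + t * v₂)) :
    HasDerivAt (fun t => contactEntropy₂ (a + t * v₁) (a' + t * v₂))
      (2 * (v₁ + v₂) * Real.log (1 - 2 * (a + t * v₁) - 2 * (a' + t * v₂))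
        - (2 * v₁ + v₂) * Real.log (4 * (a + t * v₁) + 2 * (a' + t * v₂) - 1)
        - (v₁ + 2 * v₂) * Real.log (2 * (a + t * v₁) + 4 * (a' + t * v₂) - 1)
        + v₁ * Real.log (2 * (a + t * v₁)) + v₂ * Real.log (2 * (a' + t * v₂))) t := by
  -- near `t` the point stays in the open triangle, where `s` is the five-term form
  have hopen := isOpen_densityTriangle
  have hcont : Continuous (fun τ : ℝ => ((a + τ * v₁, a' + τ * v₂) : ℝ × ℝ)) := by fun_prop
  have hmem : ∀ᶠ τ in 𝓝 t, ((a + τ * v₁, a' + τ * v₂) : ℝ × ℝ) ∈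
      {p : ℝ × ℝ | p.1 + p.2 < 1 / 2 ∧ 1 < 4 * p.1 + 2 * p.2 ∧ 1 < 2 * p.1 + 4 * p.2} :=
    hcont.continuousAt.preimage_mem_nhds (hopen.mem_nhds ⟨h1, h2, h3⟩)
  have heq : (fun τ => contactEntropy₂ (a + τ * v₁) (a' + τ * v₂)) =ᶠ[𝓝 t] fun τ =>
      negMulLog ((1 - 2 * a - 2 * a') + (-2 * (v₁ + v₂)) * τ) +
        (negMulLog ((4 * a + 2 * a' - 1) + (4 * v₁ + 2 * v₂) * τ) + negMulLog ((2 * a + 4 * a' - 1) + (2 * v₁ + 4 * v₂) * τ) -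
          negMulLog (2 * a + (2 * v₁) * τ) - negMulLog (2 * a' + (2 * v₂) * τ)) / 2 := by
    filter_upwards [hmem] with τ hτ
    obtain ⟨k1, k2, k3⟩ := hτ
    rw [contactEntropy₂_eq_negMulLog k1 k2 k3]
    congr 1
    · congr 1; ring
    · congr 1
      congr 1
      · congr 1
        · congr 1 <;> (congr 1; ring)
        · congr 1; ring
      · congr 1; ring
  have hρ : (1 - 2 * a - 2 * a') + (-2 * (v₁ + v₂)) * t ≠ 0 := by nlinarith
  have hP : (4 * a + 2 * a' - 1) + (4 * v₁ + 2 * v₂) * t ≠ 0 := by nlinarith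
  have hQ : (2 * a + 4 * a' - 1) + (2 * v₁ + 4 * v₂) * t ≠ 0 := by nlinarith
  have hA : 2 * a + (2 * v₁) * t ≠ 0 := by nlinarith
  have hA' : 2 * a' + (2 * v₂) * t ≠ 0 := by nlinarith
  have d := (hasDerivAt_negMulLog_affine hρ).add
    (((((hasDerivAt_negMulLog_affine hP).add (hasDerivAt_negMulLog_affine hQ)).sub (hasDerivAt_negMulLog_affine hA)).sub
      (hasDerivAt_negMulLog_affine hA')).div_const 2)
  refine (d.congr_of_eventuallyEq heq).congr_deriv ?_
  have e1 : (1 - 2 * a - 2 * a') + (-2 * (v₁ + v₂)) * t = 1 - 2 * (a + t * v₁) - 2 * (a' + t * v₂) := by ring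
  have e2 : (4 * a + 2 * a' - 1) + (4 * v₁ + 2 * v₂) * t = 4 * (a + t * v₁) + 2 * (a' + t * v₂) - 1 := by ring
  have e3 : (2 * a + 4 * a' - 1) + (2 * v₁ + 4 * v₂) * t = 2 * (a + t * v₁) + 4 * (a' + t * v₂) - 1 := by ring
  have e4 : 2 * a + (2 * v₁) * t = 2 * (a + t * v₁) := by ring
  have e5 : 2 * a' + (2 * v₂) * t = 2 * (a' + t * v₂) := by ring
  rw [e1, e2, e3, e4, e5]
  ring

/-- ★★★ **SECOND DIRECTIONAL DERIVATIVE = MINUS THE CURVATURE FORM**: at a point `(a,a')` of the open triangle, the derivative at `t = 0`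
of the first directional derivative `t ↦ D_v(a + tv₁, a' + tv₂)` is `−Q_{a,a'}(v)`,
`Q_{a,a'}(v) = 4(v₁+v₂)²/ρ + 2(2v₁+v₂)²/P + 2(v₁+2v₂)²/Q − v₁²/a − v₂²/a'` — the explicit Hessian of the two-density entropy.
[cite: JansevanRensburg2000, §3.3 (1st ed.; lane statement); DemboZeitouni2010, §2.2] -/
theorem hasDerivAt_dirDeriv_contactEntropy₂ {a a' : ℝ} (h1 : a + a' < 1 / 2) (h2 : 1 < 4 * a + 2 * a') (h3 : 1 < 2 * a + 4 * a')
    (v₁ v₂ : ℝ) :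
    HasDerivAt (fun t => 2 * (v₁ + v₂) * Real.log (1 - 2 * (a + t * v₁) - 2 * (a' + t * v₂))
        - (2 * v₁ + v₂) * Real.log (4 * (a + t * v₁) + 2 * (a' + t * v₂) - 1)
        - (v₁ + 2 * v₂) * Real.log (2 * (a + t * v₁) + 4 * (a' + t * v₂) - 1)
        + v₁ * Real.log (2 * (a + t * v₁)) + v₂ * Real.log (2 * (a' + t * v₂)))
      (-(4 * (v₁ + v₂) ^ 2 / (1 - 2 * a - 2 * a') + 2 * (2 * v₁ + v₂) ^ 2 / (4 * a + 2 * a' - 1)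
        + 2 * (v₁ + 2 * v₂) ^ 2 / (2 * a + 4 * a' - 1) - v₁ ^ 2 / a - v₂ ^ 2 / a')) 0 := by
  have ha : 0 < a := by linarith
  have ha' : 0 < a' := by linarith
  have hρ : (1 - 2 * a - 2 * a') + (-2 * (v₁ + v₂)) * 0 ≠ 0 := by norm_num; linarith
  have hP : (4 * a + 2 * a' - 1) + (4 * v₁ + 2 * v₂) * 0 ≠ 0 := by norm_num; linarith
  have hQ : (2 * a + 4 * a' - 1) + (2 * v₁ + 4 * v₂) * 0 ≠ 0 := by norm_num; linarith
  have hA : 2 * a + (2 * v₁) * 0 ≠ 0 := by norm_num; linarith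
  have hA' : 2 * a' + (2 * v₂) * 0 ≠ 0 := by norm_num; linarith
  have d := ((((hasDerivAt_const_mul_log_affine (2 * (v₁ + v₂)) hρ).sub (hasDerivAt_const_mul_log_affine (2 * v₁ + v₂) hP)).sub
    (hasDerivAt_const_mul_log_affine (v₁ + 2 * v₂) hQ)).add (hasDerivAt_const_mul_log_affine v₁ hA)).add
    (hasDerivAt_const_mul_log_affine v₂ hA')
  have heq : (fun t => 2 * (v₁ + v₂) * Real.log (1 - 2 * (a + t * v₁) - 2 * (a' + t * v₂))
        - (2 * v₁ + v₂) * Real.log (4 * (a + t * v₁) + 2 * (a' + t * v₂) - 1)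
        - (v₁ + 2 * v₂) * Real.log (2 * (a + t * v₁) + 4 * (a' + t * v₂) - 1)
        + v₁ * Real.log (2 * (a + t * v₁)) + v₂ * Real.log (2 * (a' + t * v₂))) =
      fun t => 2 * (v₁ + v₂) * Real.log ((1 - 2 * a - 2 * a') + (-2 * (v₁ + v₂)) * t)
        - (2 * v₁ + v₂) * Real.log ((4 * a + 2 * a' - 1) + (4 * v₁ + 2 * v₂) * t)
        - (v₁ + 2 * v₂) * Real.log ((2 * a + 4 * a' - 1) + (2 * v₁ + 4 * v₂) * t)
        + v₁ * Real.log (2 * a + (2 * v₁) * t) + v₂ * Real.log (2 * a' + (2 * v₂) * t) := by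
    funext t
    have e1 : 1 - 2 * (a + t * v₁) - 2 * (a' + t * v₂) = (1 - 2 * a - 2 * a') + (-2 * (v₁ + v₂)) * t := by ring
    have e2 : 4 * (a + t * v₁) + 2 * (a' + t * v₂) - 1 = (4 * a + 2 * a' - 1) + (4 * v₁ + 2 * v₂) * t := by ring
    have e3 : 2 * (a + t * v₁) + 4 * (a' + t * v₂) - 1 = (2 * a + 4 * a' - 1) + (2 * v₁ + 4 * v₂) * t := by ring
    have e4 : 2 * (a + t * v₁) = 2 * a + (2 * v₁) * t := by ring
    have e5 : 2 * (a' + t * v₂) = 2 * a' + (2 * v₂) * t := by ring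
    rw [e1, e2, e3, e4, e5]
  rw [heq]
  refine d.congr_deriv ?_
  simp only [mul_zero, add_zero]
  field_simp
  ring

/-! ## §2 The curvature form: sum of two squares, positive definite -/

/-- ★★★ **SUM OF TWO SQUARES**: on the open triangle, with `ρ = 1−2a−2a'`, `P = 4a+2a'−1`, `Q = 2a+4a'−1` (`P + ρ = 2a`, `Q + ρ = 2a'`),
`Q_{a,a'}(v) = ((2v₁+v₂)ρ + (v₁+v₂)P)²/(aPρ) + ((v₁+2v₂)ρ + (v₁+v₂)Q)²/(a'Qρ)`.
[cite: JansevanRensburg2000, §3.3 (1st ed.; lane statement); DemboZeitouni2010, §2.2] -/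
theorem curvatureForm_eq_sos {a a' : ℝ} (h1 : a + a' < 1 / 2) (h2 : 1 < 4 * a + 2 * a') (h3 : 1 < 2 * a + 4 * a') (v₁ v₂ : ℝ) :
    4 * (v₁ + v₂) ^ 2 / (1 - 2 * a - 2 * a') + 2 * (2 * v₁ + v₂) ^ 2 / (4 * a + 2 * a' - 1)
        + 2 * (v₁ + 2 * v₂) ^ 2 / (2 * a + 4 * a' - 1) - v₁ ^ 2 / a - v₂ ^ 2 / a' =
      ((2 * v₁ + v₂) * (1 - 2 * a - 2 * a') + (v₁ + v₂) * (4 * a + 2 * a' - 1)) ^ 2 / (a * (4 * a + 2 * a' - 1) * (1 - 2 * a - 2 * a'))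
        + ((v₁ + 2 * v₂) * (1 - 2 * a - 2 * a') + (v₁ + v₂) * (2 * a + 4 * a' - 1)) ^ 2 /
          (a' * (2 * a + 4 * a' - 1) * (1 - 2 * a - 2 * a')) := by
  have ha : (0 : ℝ) < a := by linarith
  have ha' : (0 : ℝ) < a' := by linarith
  have hρ : (0 : ℝ) < 1 - 2 * a - 2 * a' := by linarith
  have hP : (0 : ℝ) < 4 * a + 2 * a' - 1 := by linarith
  have hQ : (0 : ℝ) < 2 * a + 4 * a' - 1 := by linarith
  field_simp
  ring

/-- ★★★ **POSITIVE DEFINITENESS**: `Q_{a,a'}(v) > 0` for every `(v₁,v₂) ≠ (0,0)` at every point of the open triangle — the Hessian of the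
two-density entropy is negative definite (strict concavity with an explicit modulus).
[cite: JansevanRensburg2000, §3.3 (1st ed.: strict concavity; lane statement); DemboZeitouni2010, §2.2] -/
theorem curvatureForm_pos {a a' : ℝ} (h1 : a + a' < 1 / 2) (h2 : 1 < 4 * a + 2 * a') (h3 : 1 < 2 * a + 4 * a') {v₁ v₂ : ℝ}
    (hv : (v₁, v₂) ≠ (0, 0)) :
    0 < 4 * (v₁ + v₂) ^ 2 / (1 - 2 * a - 2 * a') + 2 * (2 * v₁ + v₂) ^ 2 / (4 * a + 2 * a' - 1)
        + 2 * (v₁ + 2 * v₂) ^ 2 / (2 * a + 4 * a' - 1) - v₁ ^ 2 / a - v₂ ^ 2 / a' := by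
  have ha : (0 : ℝ) < a := by linarith
  have ha' : (0 : ℝ) < a' := by linarith
  have hρ : (0 : ℝ) < 1 - 2 * a - 2 * a' := by linarith
  have hP : (0 : ℝ) < 4 * a + 2 * a' - 1 := by linarith
  have hQ : (0 : ℝ) < 2 * a + 4 * a' - 1 := by linarith
  rw [curvatureForm_eq_sos h1 h2 h3]
  set X := (2 * v₁ + v₂) * (1 - 2 * a - 2 * a') + (v₁ + v₂) * (4 * a + 2 * a' - 1) with hX
  set W := (v₁ + 2 * v₂) * (1 - 2 * a - 2 * a') + (v₁ + v₂) * (2 * a + 4 * a' - 1) with hW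
  have k1 : 0 ≤ X ^ 2 / (a * (4 * a + 2 * a' - 1) * (1 - 2 * a - 2 * a')) := by positivity
  have k2 : 0 ≤ W ^ 2 / (a' * (2 * a + 4 * a' - 1) * (1 - 2 * a - 2 * a')) := by positivity
  rcases (sq_nonneg X).eq_or_lt with hX0 | hXpos
  · -- `X = 0`: then `W ≠ 0` unless `v = 0`
    have hX0' : X = 0 := (pow_eq_zero_iff two_ne_zero).1 hX0.symm
    rcases (sq_nonneg W).eq_or_lt with hW0 | hWpos
    · exfalso
      have hW0' : W = 0 := (pow_eq_zero_iff two_ne_zero).1 hW0.symm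
      -- the linear system `X = W = 0` forces `v = 0`
      apply hv
      have eX : v₁ * (1 - 2 * a - 2 * a') + (v₁ + v₂) * (2 * a) = 0 := by rw [hX] at hX0'; linarith
      have eW : v₂ * (1 - 2 * a - 2 * a') + (v₁ + v₂) * (2 * a') = 0 := by rw [hW] at hW0'; linarith
      have eS : (v₁ + v₂) * (1 - 2 * a - 2 * a' + 2 * a + 2 * a') = 0 := by linarith
      have hS : v₁ + v₂ = 0 := by
        have : (1 - 2 * a - 2 * a' + 2 * a + 2 * a') = 1 := by ring
        rw [this, mul_one] at eS; exact eS
      have hv1 : v₁ = 0 := by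
        rw [hS, zero_mul, add_zero] at eX
        exact (mul_eq_zero.1 eX).resolve_right hρ.ne'
      have hv2 : v₂ = 0 := by linarith
      rw [hv1, hv2]
    · have : 0 < W ^ 2 / (a' * (2 * a + 4 * a' - 1) * (1 - 2 * a - 2 * a')) := by positivity
      linarith
  · have : 0 < X ^ 2 / (a * (4 * a + 2 * a' - 1) * (1 - 2 * a - 2 * a')) := by positivity
    linarith

/-! ## §3 The joint rate along a line: first derivative, and second derivative `+Q` -/

/-- ★★ **FIRST DERIVATIVE OF THE RATE along a line**: for `y, z > 0`, at every parameter `t` whose point lies in the open triangle,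
`d/dt J̃_{y,z}(a + tv₁, a' + tv₂) = −v₁ log y − v₂ log z − D_v(a + tv₁, a' + tv₂)` (`J̃ = log μ₁(y,z) − a log y − a' log z − s`).
[cite: DemboZeitouni2010, §2.2 (lane statement); JansevanRensburg2000, §3.3 (1st ed.)] -/
theorem hasDerivAt_jointRate_line (hy : 0 < y) (hz : 0 < z) {a a' : ℝ} (v₁ v₂ t : ℝ)
    (h1 : (a + t * v₁) + (a' + t * v₂) < 1 / 2) (h2 : 1 < 4 * (a + t * v₁) + 2 * (a' + t * v₂))
    (h3 : 1 < 2 * (a + t * v₁) + 4 * (a' + t * v₂)) :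
    HasDerivAt (fun t => jointRate y z (eosY (a + t * v₁) (a' + t * v₂)) (eosY (a' + t * v₂) (a + t * v₁)))
      (-(v₁ * Real.log y) - v₂ * Real.log z -
        (2 * (v₁ + v₂) * Real.log (1 - 2 * (a + t * v₁) - 2 * (a' + t * v₂))
          - (2 * v₁ + v₂) * Real.log (4 * (a + t * v₁) + 2 * (a' + t * v₂) - 1)
          - (v₁ + 2 * v₂) * Real.log (2 * (a + t * v₁) + 4 * (a' + t * v₂) - 1)
          + v₁ * Real.log (2 * (a + t * v₁)) + v₂ * Real.log (2 * (a' + t * v₂)))) t := by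
  have hopen := isOpen_densityTriangle
  have hcont : Continuous (fun τ : ℝ => ((a + τ * v₁, a' + τ * v₂) : ℝ × ℝ)) := by fun_prop
  have hmem : ∀ᶠ τ in 𝓝 t, ((a + τ * v₁, a' + τ * v₂) : ℝ × ℝ) ∈
      {p : ℝ × ℝ | p.1 + p.2 < 1 / 2 ∧ 1 < 4 * p.1 + 2 * p.2 ∧ 1 < 2 * p.1 + 4 * p.2} :=
    hcont.continuousAt.preimage_mem_nhds (hopen.mem_nhds ⟨h1, h2, h3⟩)
  have heq : (fun τ => jointRate y z (eosY (a + τ * v₁) (a' + τ * v₂)) (eosY (a' + τ * v₂) (a + τ * v₁))) =ᶠ[𝓝 t] fun τ =>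
      Real.log (stripMuY₂ 1 y z) - ((a + τ * v₁) * Real.log y + (a' + τ * v₂) * Real.log z) -
        contactEntropy₂ (a + τ * v₁) (a' + τ * v₂) := by
    filter_upwards [hmem] with τ hτ
    obtain ⟨k1, k2, k3⟩ := hτ
    rw [jointRate_eq_sub_contactEntropy₂ hy hz k1 k2 k3]; ring
  have dlin : HasDerivAt (fun τ : ℝ => Real.log (stripMuY₂ 1 y z) - ((a + τ * v₁) * Real.log y + (a' + τ * v₂) * Real.log z))
      (-(v₁ * Real.log y + v₂ * Real.log z)) t := by
    have e1 : HasDerivAt (fun τ : ℝ => (a + τ * v₁) * Real.log y) (v₁ * Real.log y) t := by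
      simpa using (((hasDerivAt_id t).mul_const v₁).const_add a).mul_const (Real.log y)
    have e2 : HasDerivAt (fun τ : ℝ => (a' + τ * v₂) * Real.log z) (v₂ * Real.log z) t := by
      simpa using (((hasDerivAt_id t).mul_const v₂).const_add a').mul_const (Real.log z)
    simpa using (e1.add e2).const_sub (Real.log (stripMuY₂ 1 y z))
  have d := dlin.sub (hasDerivAt_contactEntropy₂_line v₁ v₂ t h1 h2 h3)
  refine (d.congr_of_eventuallyEq heq).congr_deriv ?_
  ring

/-- ★★ **SECOND DERIVATIVE OF THE RATE = THE CURVATURE FORM**: at a point of the open triangle, the derivative at `t = 0` of the first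
derivative `t ↦ −v₁ log y − v₂ log z − D_v(a + tv₁, a' + tv₂)` of the rate along the line is `+Q_{a,a'}(v)` — for every `(y,z)`: the
Hessian of `J̃_{y,z}` in density coordinates is the POSITIVE DEFINITE form `Q`, the same at all fugacities.
[cite: DemboZeitouni2010, §2.2 (lane statement); JansevanRensburg2000, §3.3 (1st ed.)] -/
theorem hasDerivAt_dirDeriv_jointRate (y z : ℝ) {a a' : ℝ} (h1 : a + a' < 1 / 2) (h2 : 1 < 4 * a + 2 * a')
    (h3 : 1 < 2 * a + 4 * a') (v₁ v₂ : ℝ) :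
    HasDerivAt (fun t => -(v₁ * Real.log y) - v₂ * Real.log z -
        (2 * (v₁ + v₂) * Real.log (1 - 2 * (a + t * v₁) - 2 * (a' + t * v₂))
          - (2 * v₁ + v₂) * Real.log (4 * (a + t * v₁) + 2 * (a' + t * v₂) - 1)
          - (v₁ + 2 * v₂) * Real.log (2 * (a + t * v₁) + 4 * (a' + t * v₂) - 1)
          + v₁ * Real.log (2 * (a + t * v₁)) + v₂ * Real.log (2 * (a' + t * v₂))))
      (4 * (v₁ + v₂) ^ 2 / (1 - 2 * a - 2 * a') + 2 * (2 * v₁ + v₂) ^ 2 / (4 * a + 2 * a' - 1)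
        + 2 * (v₁ + 2 * v₂) ^ 2 / (2 * a + 4 * a' - 1) - v₁ ^ 2 / a - v₂ ^ 2 / a') 0 := by
  have d := (hasDerivAt_dirDeriv_contactEntropy₂ h1 h2 h3 v₁ v₂).const_sub (-(v₁ * Real.log y) - v₂ * Real.log z)
  refine d.congr_deriv ?_
  ring

/-! ## §4 The quadratic germ of the rate at the typical pair -/

/-- The first directional derivative of the rate vanishes at the typical pair `b = (b(y,z), b(z,y))`:
`−v₁ log y − v₂ log z − D_v(b) = 0` (because `Y(b) = y`, `Y'(b) = z`). [cite: DemboZeitouni2010, §2.2 (lane statement)] -/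
theorem dirDeriv_jointRate_typical_eq_zero (hy : 0 < y) (hz : 0 < z) (v₁ v₂ : ℝ) :
    -(v₁ * Real.log y) - v₂ * Real.log z -
        (2 * (v₁ + v₂) * Real.log (1 - 2 * contactB y z - 2 * contactB z y)
          - (2 * v₁ + v₂) * Real.log (4 * contactB y z + 2 * contactB z y - 1)
          - (v₁ + 2 * v₂) * Real.log (2 * contactB y z + 4 * contactB z y - 1)
          + v₁ * Real.log (2 * contactB y z) + v₂ * Real.log (2 * contactB z y)) = 0 := by
  obtain ⟨t1, t2, t3⟩ := contactB_mem_triangle hy hz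
  obtain ⟨eY, eZ⟩ := eosY_contactB hy hz
  set b := contactB y z with hb
  set b' := contactB z y with hb'
  have hρ : (0 : ℝ) < 1 - 2 * b - 2 * b' := by linarith
  have hP : (0 : ℝ) < 4 * b + 2 * b' - 1 := by linarith
  have hQ : (0 : ℝ) < 2 * b + 4 * b' - 1 := by linarith
  have h2b : (0 : ℝ) < 2 * b := by linarith
  have h2b' : (0 : ℝ) < 2 * b' := by linarith
  have eY' : y = (4 * b + 2 * b' - 1) ^ 2 * (2 * b + 4 * b' - 1) / ((2 * b) * (1 - 2 * b - 2 * b') ^ 2) := by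
    rw [← eY]; unfold eosY; ring
  have eZ' : z = (2 * b + 4 * b' - 1) ^ 2 * (4 * b + 2 * b' - 1) / ((2 * b') * (1 - 2 * b - 2 * b') ^ 2) := by
    rw [← eZ]; unfold eosY; ring
  have lY : Real.log y = 2 * Real.log (4 * b + 2 * b' - 1) + Real.log (2 * b + 4 * b' - 1) -
      (Real.log (2 * b) + 2 * Real.log (1 - 2 * b - 2 * b')) := by
    rw [eY', Real.log_div (by positivity) (by positivity), Real.log_mul (by positivity) (by positivity), Real.log_pow,
      Real.log_mul (by positivity) (by positivity), Real.log_pow]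
    push_cast; ring
  have lZ : Real.log z = 2 * Real.log (2 * b + 4 * b' - 1) + Real.log (4 * b + 2 * b' - 1) -
      (Real.log (2 * b') + 2 * Real.log (1 - 2 * b - 2 * b')) := by
    rw [eZ', Real.log_div (by positivity) (by positivity), Real.log_mul (by positivity) (by positivity), Real.log_pow,
      Real.log_mul (by positivity) (by positivity), Real.log_pow]
    push_cast; ring
  rw [lY, lZ]; ring

/-- ★★★ **THE QUADRATIC GERM OF THE RATE FUNCTION AT THE TYPICAL PAIR**: for `y, z > 0` and every direction `(v₁,v₂)`,
`J̃_{y,z}(b(y,z) + t v₁, b(z,y) + t v₂) / t² → Q_b(v)/2` as `t → 0` (`t ≠ 0`), with the explicit positive definite curvature form `Q_b` of §2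
at the typical pair `b`: near its unique zero the rate function is the quadratic form `½ Q_b` to second order.  (`Q_b⁻¹` is the covariance
matrix a central limit theorem for `(bc, tc)/√N` would carry — NOT claimed here.)
Proof: `J̃(b) = 0`, the first derivative along the line vanishes at `0` (`dirDeriv_jointRate_typical_eq_zero`), the second is `Q_b(v)`
(§3); l'Hôpital once and the definition of the derivative.
[cite: DemboZeitouni2010, §2.2 (rate function near its zero; lane statement) and §3.7 (moderate deviations, context); JansevanRensburg2000, §3.3 (1st ed.)] -/
theorem tendsto_jointRate_typical_div_sq (hy : 0 < y) (hz : 0 < z) (v₁ v₂ : ℝ) :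
    Tendsto (fun t : ℝ => jointRate y z (eosY (contactB y z + t * v₁) (contactB z y + t * v₂))
        (eosY (contactB z y + t * v₂) (contactB y z + t * v₁)) / t ^ 2) (𝓝[≠] 0)
      (𝓝 ((4 * (v₁ + v₂) ^ 2 / (1 - 2 * contactB y z - 2 * contactB z y)
        + 2 * (2 * v₁ + v₂) ^ 2 / (4 * contactB y z + 2 * contactB z y - 1)
        + 2 * (v₁ + 2 * v₂) ^ 2 / (2 * contactB y z + 4 * contactB z y - 1)
        - v₁ ^ 2 / contactB y z - v₂ ^ 2 / contactB z y) / 2)) := by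
  obtain ⟨t1, t2, t3⟩ := contactB_mem_triangle hy hz
  obtain ⟨eY, eZ⟩ := eosY_contactB hy hz
  set b := contactB y z with hb
  set b' := contactB z y with hb'
  -- the rate along the line, its derivative, and the curvature
  set g : ℝ → ℝ := fun t => jointRate y z (eosY (b + t * v₁) (b' + t * v₂)) (eosY (b' + t * v₂) (b + t * v₁)) with hg
  set g' : ℝ → ℝ := fun t => -(v₁ * Real.log y) - v₂ * Real.log z -
        (2 * (v₁ + v₂) * Real.log (1 - 2 * (b + t * v₁) - 2 * (b' + t * v₂))
          - (2 * v₁ + v₂) * Real.log (4 * (b + t * v₁) + 2 * (b' + t * v₂) - 1)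
          - (v₁ + 2 * v₂) * Real.log (2 * (b + t * v₁) + 4 * (b' + t * v₂) - 1)
          + v₁ * Real.log (2 * (b + t * v₁)) + v₂ * Real.log (2 * (b' + t * v₂))) with hg'
  set Qv := 4 * (v₁ + v₂) ^ 2 / (1 - 2 * b - 2 * b') + 2 * (2 * v₁ + v₂) ^ 2 / (4 * b + 2 * b' - 1)
        + 2 * (v₁ + 2 * v₂) ^ 2 / (2 * b + 4 * b' - 1) - v₁ ^ 2 / b - v₂ ^ 2 / b' with hQv
  -- points of the line near `0` are in the triangle
  have hopen := isOpen_densityTriangle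
  have hcont : Continuous (fun τ : ℝ => ((b + τ * v₁, b' + τ * v₂) : ℝ × ℝ)) := by fun_prop
  have hmem : ∀ᶠ τ in 𝓝 (0 : ℝ), ((b + τ * v₁, b' + τ * v₂) : ℝ × ℝ) ∈
      {p : ℝ × ℝ | p.1 + p.2 < 1 / 2 ∧ 1 < 4 * p.1 + 2 * p.2 ∧ 1 < 2 * p.1 + 4 * p.2} := by
    refine hcont.continuousAt.preimage_mem_nhds (hopen.mem_nhds ?_)
    simp only [zero_mul, add_zero]; exact ⟨t1, t2, t3⟩
  have hder : ∀ᶠ τ in 𝓝 (0 : ℝ), HasDerivAt g (g' τ) τ := by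
    filter_upwards [hmem] with τ hτ
    obtain ⟨k1, k2, k3⟩ := hτ
    exact hasDerivAt_jointRate_line hy hz v₁ v₂ τ k1 k2 k3
  have hg0 : g 0 = 0 := by
    simp only [hg, zero_mul, add_zero]
    rw [eY, eZ]; exact jointRate_self hy hz
  have hg'0 : g' 0 = 0 := by
    simp only [hg', zero_mul, add_zero]
    exact dirDeriv_jointRate_typical_eq_zero hy hz v₁ v₂
  have hg'' : HasDerivAt g' Qv 0 := hasDerivAt_dirDeriv_jointRate y z t1 t2 t3 v₁ v₂
  -- l'Hôpital: `g/t² → Q/2` from `g'/(2t) → Q/2`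
  have hsq : ∀ᶠ τ in 𝓝[≠] (0 : ℝ), HasDerivAt (fun t : ℝ => t ^ 2) (2 * τ) τ := by
    refine Filter.Eventually.of_forall fun τ => ?_
    simpa using hasDerivAt_pow 2 τ
  have hne : ∀ᶠ τ in 𝓝[≠] (0 : ℝ), (2 : ℝ) * τ ≠ 0 := by
    refine eventually_nhdsWithin_of_forall fun τ hτ => ?_
    exact mul_ne_zero two_ne_zero hτ
  have hga : Tendsto (fun t : ℝ => t ^ 2) (𝓝[≠] (0 : ℝ)) (𝓝 0) := by
    have : Tendsto (fun t : ℝ => t ^ 2) (𝓝 (0 : ℝ)) (𝓝 (0 ^ 2)) := (continuous_pow 2).tendsto 0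
    simpa using this.mono_left nhdsWithin_le_nhds
  have hfa : Tendsto g (𝓝[≠] (0 : ℝ)) (𝓝 0) := by
    have hc : ContinuousAt g 0 := (hder.self_of_nhds).continuousAt
    have := hc.tendsto
    rw [hg0] at this
    exact this.mono_left nhdsWithin_le_nhds
  have hdiv : Tendsto (fun t => g' t / (2 * t)) (𝓝[≠] (0 : ℝ)) (𝓝 (Qv / 2)) := by
    have hs := (hasDerivAt_iff_tendsto_slope_zero.1 hg'')
    simp only [zero_add, hg'0, sub_zero, smul_eq_mul] at hs
    have := hs.const_mul (1 / 2 : ℝ)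
    refine (this.congr fun t => ?_).trans ?_
    · ring
    · rw [show (1 / 2 : ℝ) * Qv = Qv / 2 by ring]
  exact HasDerivAt.lhopital_zero_nhdsNE (hder.filter_mono nhdsWithin_le_nhds) hsq hne hfa hga hdiv

end Literature.Probability.RandomPlanarGeometry.SAW.HexBW
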